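import Literature.Probability.RandomPlanarGeometry.SAWPulledLargeForceExpansionZdCostPolynomial
import Literature.Probability.RandomPlanarGeometry.SAWPulledLargeForceExpansionZdEvenDimension
import Literature.Probability.RandomPlanarGeometry.BDGS2012HaraSladeIntegrality
import HarnessLib

/-!
# Pulled SAW on `ℤ^{d+1}` at large force: the HYPEROCTAHEDRAL SYMMETRY of the cost census —
# `2^u · u! ∣ F_{c,n}(u)` and `N_{c,n}(ℤ^{d+1}) = Σ_u G_{c,n}(u) · 2d(2d−2)⋯(2d−2u+2)`, an integer polynomial in `2d`

Topic `Literature/Probability/RandomPlanarGeometry` (continues `SAWPulledLargeForceExpansionZdCostPolynomial.lean`: the axis-class identity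
`costCoeffZd_eq_sum_choose_mul`, `N_{c,n}(ℤ^{d+1}) = Σ_{u ≤ c} C(d,u) F_{c,n}(u)` with `F_{c,n}(u)` the number of irreducible bridges of `ℤ^{u+1}` of
cost `c`, length `n` using every lateral axis; `SAWPulledLargeForceExpansionZdEvenDimension.lean`: `costCoeffZd_zero_dim_eq_zero`;
`SAWPulledLargeForceExpansionZdParity.lean`: `isBridge_congr_zero`, `isIrreducibleBridge_congr_zero`; and uses the free-action orbit count
`card_dvd_card_of_free_action` of `BDGS2012HaraSladeIntegrality.lean`, where the same device closes the integrality of the `1/d` expansion of `μ`).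

PRINTED CONTEXT (locators only; no number is taken from print). Graham (2010), §4: "There are `2^d d!` ways of choosing an ordered orthonormal
basis for `ℝ^d` from the set `ℤ^d`. Each simple walk in `ℤ^d` with dimensionality `D` is equivalent to `2d(2d-2)⋯(2d-2D+2)` other walks under the
action of this group of symmetries … we can write the number of walks … as a polynomial in powers of `s⁻¹ = 2d`" — the hyperoctahedral device,
there for lace-graph counts. Madras–Slade (1993), §1.1 eq. (1.1.8) (p. 5): the `1/d` expansion. Janse van Rensburg–Whittington (2013), §3.2
Theorem 8: the first order `e^{λ_B} = y + 2d + O(1/y)` of the pulled walk on `ℤ^{d+1}`. NOT IN PRINT in these sources (lane statement): the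
application to IRREDUCIBLE BRIDGES GRADED BY COST, i.e. to the census `N_{c,n}` behind the large-force coefficients `c_k^{(d)}`.

THIS FILE (lane «pcv-sawmu», a-p3 g25; all PROVED, standard axioms; one tool definition `latRelabel`):
* §1 `latRelabel u (τ, ε)` — the signed relabelling of the `u` lateral axes of `ℤ^{u+1}` (force coordinate kept; axis `b+1 ↦ τ b + 1`, sign flipped
  where `ε b`): additive, injective, composition = the hyperoctahedral multiplication (`latRelabel_latRelabel`), inverse (`latRelabel_symm_latRelabel`),
  unit vectors to unit vectors; it preserves adjacency, self-avoiding walks, irreducible bridges, the cost and the «all axes used» property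
  (`comp_latRelabel_mem_saws_iff`, `comp_latRelabel_mem_irreducibleBridges_iff`, `costZd_comp_latRelabel`, `forall_exists_latRelabel_iff`);
* §2 ★ `latRelabel_free` — the action is FREE on self-avoiding walks using every lateral axis (a used axis owns a step `±e_a`, whose image pins
  `τ` and `ε` at that axis); ★★ `two_pow_mul_factorial_dvd_card_allAxesClass` — **`2^u · u! ∣ F_{c,n}(u)`**;
* §3 ★★★ `costCoeffZd_eq_sum_classes_mul_descFactorial` — **`N_{c,n}(ℤ^{d+1}) = Σ_{u ≤ c} G_{c,n}(u) · 2^u · d(d−1)⋯(d−u+1)`** for EVERY `d`, with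
  `G_{c,n}(u) = F_{c,n}(u)/(2^u u!) ∈ ℕ` the number of hyperoctahedral classes (`exists_costCoeffZd_eq_sum_mul_descFactorial`: `G(0) = 0` for `c ≥ 1`);
  ★★★ `exists_int_polynomial_costCoeffZd` — **`N_{c,n}(ℤ^{d+1}) = P_{c,n}(2d)` with `P_{c,n} ∈ ℤ[X]` of degree `≤ c` and, for `c ≥ 1`, zero constant
  term** (`P_{c,n} = Σ_u G_{c,n}(u) ∏_{i<u} (X − 2i)`). The sequel `SAWPulledLargeForceExpansionZdIntegrality.lean` feeds this through the cost-series
  engine: every `c_k^{(d)}` is an integer polynomial in `2d`, divisible by `2d` in `ℤ[2d]`.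
[cite: Graham2010, Section 4] [cite: MadrasSlade1993, §1.1 eq. (1.1.8) p. 5; §4.2 eq. (4.2.20)–(4.2.22) p. 94 (cost)] [cite: JansevanRensburgWhittington2013,
§3.2 Theorem 8 (arXiv v4 p. 11)] [cite: DuminilCopinHammond2013, §2.2 (irreducible bridges)]

Provenance: lane «pcv-sawmu», a-p3 g25 (2026-08-28). PURE STD, no data, no census value used.
-/

noncomputable section

open Finset
open scoped BigOperators
open Literature.Probability.LatticeModels
open Literature.Probability.RandomPlanarGeometry.SAW

namespace Literature.Probability.RandomPlanarGeometry.SAW.Zd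

/-! ## §1 Signed relabelling of the lateral axes of `ℤ^{u+1}` -/

section Relabel

variable (u : ℕ)

/-- The signed relabelling of the lateral axes of `ℤ^{u+1}` by `g = (τ, ε)`: the force coordinate `x₀` is kept, the lateral axis
`b+1` is carried to the axis `τ b + 1`, with the sign of the coordinate flipped where `ε b` (an element of the hyperoctahedral group
of the `u` lateral axes, of order `2^u · u!`). [cite: Graham2010, Section 4] -/
def latRelabel (g : Equiv.Perm (Fin u) × (Fin u → Bool)) (x : Site (u + 1)) : Site (u + 1) :=
  fun a => Fin.cases (motive := fun _ => ℤ) (x 0)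
    (fun b => if g.2 (g.1.symm b) then -x (g.1.symm b).succ else x (g.1.symm b).succ) a

variable {u}
variable (g : Equiv.Perm (Fin u) × (Fin u → Bool))

/-- The force coordinate is kept. [cite: Graham2010, Section 4] -/
@[simp] theorem latRelabel_apply_zero (x : Site (u + 1)) : latRelabel u g x 0 = x 0 := rfl

/-- The new lateral coordinate `b+1` is `±` the old coordinate `τ⁻¹ b + 1`. [cite: Graham2010, Section 4] -/
theorem latRelabel_apply_succ (x : Site (u + 1)) (b : Fin u) :
    latRelabel u g x b.succ = if g.2 (g.1.symm b) then -x (g.1.symm b).succ else x (g.1.symm b).succ := rfl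

/-- The old lateral coordinate `b+1` lands, up to sign, at `τ b + 1`. [cite: Graham2010, Section 4] -/
theorem latRelabel_apply_succ_perm (x : Site (u + 1)) (b : Fin u) :
    latRelabel u g x (g.1 b).succ = if g.2 b then -x b.succ else x b.succ := by
  rw [latRelabel_apply_succ, Equiv.symm_apply_apply]

/-- The relabelling is additive. [cite: Graham2010, Section 4] -/
theorem latRelabel_add (x y : Site (u + 1)) : latRelabel u g (x + y) = latRelabel u g x + latRelabel u g y := by
  funext a
  refine Fin.cases ?_ (fun b => ?_) a
  · simp
  · simp only [Pi.add_apply, latRelabel_apply_succ]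
    split_ifs <;> ring

/-- The relabelling commutes with negation. [cite: Graham2010, Section 4] -/
theorem latRelabel_neg (x : Site (u + 1)) : latRelabel u g (-x) = -latRelabel u g x := by
  funext a
  refine Fin.cases ?_ (fun b => ?_) a
  · simp
  · simp only [Pi.neg_apply, latRelabel_apply_succ]
    split_ifs <;> ring

/-- The relabelling is subtractive. [cite: Graham2010, Section 4] -/
theorem latRelabel_sub (x y : Site (u + 1)) : latRelabel u g (x - y) = latRelabel u g x - latRelabel u g y := by
  rw [sub_eq_add_neg, latRelabel_add, latRelabel_neg, ← sub_eq_add_neg]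

/-- The relabelling fixes the origin. [cite: Graham2010, Section 4] -/
@[simp] theorem latRelabel_zero : latRelabel u g (0 : Site (u + 1)) = 0 := by
  funext a
  refine Fin.cases ?_ (fun b => ?_) a
  · simp
  · simp [latRelabel_apply_succ]

/-- COMPOSITION: `(τ,ε) ∘ (τ',ε') = (ττ', j ↦ ε' j xor ε (τ' j))` (the multiplication of the hyperoctahedral group).
[cite: Graham2010, Section 4] -/
theorem latRelabel_latRelabel (h : Equiv.Perm (Fin u) × (Fin u → Bool)) (x : Site (u + 1)) :
    latRelabel u g (latRelabel u h x) = latRelabel u (g.1 * h.1, fun j => xor (h.2 j) (g.2 (h.1 j))) x := by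
  funext a
  refine Fin.cases ?_ (fun b => ?_) a
  · simp
  · simp only [latRelabel_apply_succ]
    have hs : (g.1 * h.1).symm b = h.1.symm (g.1.symm b) := by
      simp [Equiv.Perm.mul_def]
    rw [hs, Equiv.apply_symm_apply]
    cases g.2 (g.1.symm b) <;> cases h.2 (h.1.symm (g.1.symm b)) <;> simp

/-- The inverse relabelling `(τ⁻¹, ε ∘ τ⁻¹)` undoes `(τ, ε)`. [cite: Graham2010, Section 4] -/
theorem latRelabel_symm_latRelabel (x : Site (u + 1)) :
    latRelabel u (g.1.symm, fun j => g.2 (g.1.symm j)) (latRelabel u g x) = x := by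
  funext a
  refine Fin.cases ?_ (fun b => ?_) a
  · simp
  · simp only [latRelabel_apply_succ, Equiv.symm_symm, Equiv.symm_apply_apply]
    cases g.2 b <;> simp

/-- The relabelling is injective. [cite: Graham2010, Section 4] -/
theorem latRelabel_injective : Function.Injective (latRelabel u g) := fun x y hxy => by
  simpa only [latRelabel_symm_latRelabel] using congrArg (latRelabel u (g.1.symm, fun j => g.2 (g.1.symm j))) hxy

/-- The vertical unit vector is fixed. [cite: Graham2010, Section 4] -/
theorem latRelabel_single_zero (s : ℤ) : latRelabel u g (Pi.single 0 s) = Pi.single 0 s := by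
  funext a
  refine Fin.cases ?_ (fun b => ?_) a
  · simp
  · simp [latRelabel_apply_succ]

/-- A lateral unit vector `s·e_{b+1}` goes to `±s·e_{τ b + 1}`. [cite: Graham2010, Section 4] -/
theorem latRelabel_single_succ (b : Fin u) (s : ℤ) :
    latRelabel u g (Pi.single b.succ s) = Pi.single (g.1 b).succ (if g.2 b then -s else s) := by
  funext a
  refine Fin.cases ?_ (fun b' => ?_) a
  · simp
  · rw [latRelabel_apply_succ]
    by_cases hb : b' = g.1 b
    · subst hb
      simp only [Equiv.symm_apply_apply, Pi.single_eq_same]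
    · have h1 : (g.1.symm b').succ ≠ b.succ := fun h => hb (by
        have := Fin.succ_injective _ h
        rw [← this, Equiv.apply_symm_apply])
      have h2 : b'.succ ≠ (g.1 b).succ := fun h => hb (Fin.succ_injective _ h)
      rw [Pi.single_eq_of_ne h1, Pi.single_eq_of_ne h2]
      simp

/-- The relabelling preserves adjacency in `ℤ^{u+1}`. [cite: Graham2010, Section 4] -/
theorem zdGraph_adj_latRelabel {x y : Site (u + 1)} (hxy : (zdGraph (u + 1)).Adj x y) :
    (zdGraph (u + 1)).Adj (latRelabel u g x) (latRelabel u g y) := by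
  rw [zdGraph_adj_iff_sub] at hxy ⊢
  rw [← latRelabel_sub, ← latRelabel_sub]
  obtain ⟨j, hj⟩ := hxy
  -- the unit vector `e_j` goes to `± e_{j'}`
  have key : ∀ v w : Site (u + 1), v = Pi.single j 1 → w = -v →
      ∃ i, (latRelabel u g v = Pi.single i 1 ∧ latRelabel u g w = -Pi.single i 1) ∨
        (latRelabel u g w = Pi.single i 1 ∧ latRelabel u g v = -Pi.single i 1) := by
    rintro v w rfl rfl
    refine Fin.cases ?_ (fun b => ?_) j
    · exact ⟨0, Or.inl ⟨latRelabel_single_zero g 1, by rw [latRelabel_neg, latRelabel_single_zero]⟩⟩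
    · refine ⟨(g.1 b).succ, ?_⟩
      rw [latRelabel_neg, latRelabel_single_succ]
      cases g.2 b
      · exact Or.inl ⟨by simp, by simp⟩
      · exact Or.inr ⟨by simp [Pi.single_neg], by simp [Pi.single_neg]⟩
  rcases hj with hj | hj
  · obtain ⟨i, hi | hi⟩ := key (y - x) (x - y) hj (by rw [neg_sub])
    · exact ⟨i, Or.inl hi.1⟩
    · exact ⟨i, Or.inr hi.1⟩
  · obtain ⟨i, hi | hi⟩ := key (x - y) (y - x) hj (by rw [neg_sub])
    · exact ⟨i, Or.inr hi.1⟩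
    · exact ⟨i, Or.inl hi.1⟩

/-- The relabelling preserves adjacency (iff form). [cite: Graham2010, Section 4] -/
theorem zdGraph_adj_latRelabel_iff (x y : Site (u + 1)) :
    (zdGraph (u + 1)).Adj (latRelabel u g x) (latRelabel u g y) ↔ (zdGraph (u + 1)).Adj x y := by
  refine ⟨fun hxy => ?_, zdGraph_adj_latRelabel g⟩
  have := zdGraph_adj_latRelabel (g.1.symm, fun j => g.2 (g.1.symm j)) hxy
  simpa only [latRelabel_symm_latRelabel] using this

/-- The relabelled walk is a self-avoiding walk iff the walk is. [cite: MadrasSlade1993, §1.1] -/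
theorem comp_latRelabel_mem_saws_iff {n : ℕ} (ω : ℕ → Site (u + 1)) :
    (fun i => latRelabel u g (ω i)) ∈ saws (u + 1) n ↔ ω ∈ saws (u + 1) n := by
  rw [mem_saws, mem_saws]
  have h0 : latRelabel u g (ω 0) = 0 ↔ ω 0 = 0 := by
    constructor
    · intro h; exact latRelabel_injective g (by rw [h, latRelabel_zero])
    · intro h; rw [h, latRelabel_zero]
  simp only [h0, (latRelabel_injective g).eq_iff, zdGraph_adj_latRelabel_iff]
  refine and_congr_right fun _ => and_congr_right fun _ => and_congr_right fun _ => ?_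
  constructor
  · intro h i hi j hj hij
    exact h hi hj (by simp only [hij])
  · intro h i hi j hj hij
    exact h hi hj (latRelabel_injective g hij)

/-- The relabelled walk is an irreducible bridge iff the walk is (bridges, renewal times and irreducibility are read off the force
coordinate, which is kept). [cite: DuminilCopinHammond2013, §2.2] -/
theorem comp_latRelabel_mem_irreducibleBridges_iff {n : ℕ} (ω : ℕ → Site (u + 1)) :
    (fun i => latRelabel u g (ω i)) ∈ irreducibleBridges (u + 1) n ↔ ω ∈ irreducibleBridges (u + 1) n := by
  have h0 : ∀ i, (fun i => latRelabel u g (ω i)) i 0 = ω i 0 := fun i => latRelabel_apply_zero g (ω i)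
  rw [mem_irreducibleBridges, mem_irreducibleBridges, mem_bridges, mem_bridges, comp_latRelabel_mem_saws_iff,
    isBridge_congr_zero h0, isIrreducibleBridge_congr_zero h0]

/-- The cost is unchanged by the relabelling. [cite: MadrasSlade1993, §4.2, eq. (4.2.20)–(4.2.22) (p. 94, 2013 reprint)] -/
@[simp] theorem costZd_comp_latRelabel (n : ℕ) (ω : ℕ → Site (u + 1)) :
    costZd u n (fun i => latRelabel u g (ω i)) = costZd u n ω := by
  simp [costZd]

/-- The relabelled walk uses every lateral axis iff the walk does. [cite: Graham2010, Section 4] -/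
theorem forall_exists_latRelabel_iff {n : ℕ} (ω : ℕ → Site (u + 1)) :
    (∀ a : Fin (u + 1), a ≠ 0 → ∃ i ≤ n, latRelabel u g (ω i) a ≠ (0 : ℤ)) ↔
      (∀ a : Fin (u + 1), a ≠ 0 → ∃ i ≤ n, ω i a ≠ (0 : ℤ)) := by
  have key : ∀ (h : Equiv.Perm (Fin u) × (Fin u → Bool)) (ω : ℕ → Site (u + 1)),
      (∀ a : Fin (u + 1), a ≠ 0 → ∃ i ≤ n, ω i a ≠ (0 : ℤ)) →
      (∀ a : Fin (u + 1), a ≠ 0 → ∃ i ≤ n, latRelabel u h (ω i) a ≠ (0 : ℤ)) := by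
    intro h ω hall a ha
    obtain ⟨b, rfl⟩ := Fin.exists_succ_eq.2 ha
    obtain ⟨i, hi, hne⟩ := hall (h.1.symm b).succ (Fin.succ_ne_zero _)
    refine ⟨i, hi, ?_⟩
    rw [latRelabel_apply_succ]
    split_ifs
    · exact neg_ne_zero.2 hne
    · exact hne
  refine ⟨fun hall => ?_, key g ω⟩
  have := key (g.1.symm, fun j => g.2 (g.1.symm j)) (fun i => latRelabel u g (ω i)) hall
  simpa only [latRelabel_symm_latRelabel] using this

end Relabel

/-! ## §2 The action on the «all axes used» classes is free: `2^u · u!` divides `F_{c,n}(u)` -/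

section Free

variable {u n : ℕ}

/-- The steps of a self-avoiding walk are unit coordinate vectors `± e_j`. [cite: MadrasSlade1993, §1.1 (p. 1); lane plumbing] -/
private theorem exists_step_single_hyp {D : ℕ} {ω : ℕ → Site D} (hω : ω ∈ saws D n) {k : ℕ} (hk : k < n) :
    ∃ j : Fin D, ∃ s : ℤ, (s = 1 ∨ s = -1) ∧ ω (k + 1) - ω k = Pi.single j s := by
  obtain ⟨j, hj | hj⟩ := (zdGraph_adj_iff_sub _ _).1 ((mem_saws.1 hω).2.2.1 k hk)
  · exact ⟨j, 1, Or.inl rfl, hj⟩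
  · refine ⟨j, -1, Or.inr rfl, ?_⟩
    rw [Pi.single_neg, ← hj, neg_sub]

/-- A coordinate that is nonzero at some time was changed by an earlier step. [cite: MadrasSlade1993, §1.1 (p. 1); lane plumbing] -/
private theorem exists_step_ne_hyp {D : ℕ} {ω : ℕ → Site D} (h0 : ω 0 = 0) {a : Fin D} {i : ℕ} (hi : ω i a ≠ 0) :
    ∃ k < i, ω (k + 1) a ≠ ω k a := by
  induction i with
  | zero => exact absurd (by rw [h0]; rfl) hi
  | succ i ih =>
    by_cases h : ω (i + 1) a = ω i a
    · obtain ⟨k, hk, hne⟩ := ih (by rwa [h] at hi)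
      exact ⟨k, by omega, hne⟩
    · exact ⟨i, by omega, h⟩

/-- A used axis owns a step `± e_a`. [cite: MadrasSlade1993, §1.1 (p. 1); lane plumbing] -/
private theorem exists_step_eq_single_hyp {ω : ℕ → Site (u + 1)} (hω : ω ∈ saws (u + 1) n) {a : Fin (u + 1)}
    (ha : ∃ i ≤ n, ω i a ≠ (0 : ℤ)) : ∃ k < n, ∃ s : ℤ, (s = 1 ∨ s = -1) ∧ ω (k + 1) - ω k = Pi.single a s := by
  obtain ⟨i, hi, hne⟩ := ha
  obtain ⟨k, hk, hka⟩ := exists_step_ne_hyp (mem_saws.1 hω).1 hne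
  obtain ⟨j, s, hs, hjs⟩ := exists_step_single_hyp hω (show k < n by omega)
  have hja : j = a := by
    by_contra hja
    have h := congrFun hjs a
    rw [Pi.sub_apply, Pi.single_eq_of_ne (Ne.symm hja)] at h
    exact hka (sub_eq_zero.1 h)
  subst hja
  exact ⟨k, by omega, s, hs, hjs⟩

/-- ★ FREENESS: two signed relabellings that agree on a self-avoiding walk using every lateral axis are equal ("each simple walk … with
dimensionality `D` is equivalent to `2d(2d−2)⋯(2d−2D+2)` other walks under the action of this group of symmetries").
[cite: Graham2010, Section 4] -/
theorem latRelabel_free {g h : Equiv.Perm (Fin u) × (Fin u → Bool)} {ω : ℕ → Site (u + 1)} (hω : ω ∈ saws (u + 1) n)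
    (hall : ∀ a : Fin (u + 1), a ≠ 0 → ∃ i ≤ n, ω i a ≠ (0 : ℤ))
    (he : (fun i => latRelabel u g (ω i)) = fun i => latRelabel u h (ω i)) : g = h := by
  have key : ∀ b : Fin u, g.1 b = h.1 b ∧ g.2 b = h.2 b := by
    intro b
    obtain ⟨k, -, s, hs, hstep⟩ := exists_step_eq_single_hyp hω (hall b.succ (Fin.succ_ne_zero _))
    have hk1 : latRelabel u g (ω (k + 1)) = latRelabel u h (ω (k + 1)) := congrFun he (k + 1)
    have hk0 : latRelabel u g (ω k) = latRelabel u h (ω k) := congrFun he k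
    have h1 : latRelabel u g (ω (k + 1) - ω k) = latRelabel u h (ω (k + 1) - ω k) := by
      rw [latRelabel_sub, latRelabel_sub, hk1, hk0]
    rw [hstep, latRelabel_single_succ, latRelabel_single_succ] at h1
    have hv : (if g.2 b then -s else s) ≠ 0 := by
      rcases hs with rfl | rfl <;> cases g.2 b <;> decide
    have hidx : (g.1 b).succ = (h.1 b).succ := by
      by_contra hne
      have h2 := congrFun h1 (g.1 b).succ
      rw [Pi.single_eq_same, Pi.single_eq_of_ne hne] at h2
      exact hv h2
    refine ⟨Fin.succ_injective _ hidx, ?_⟩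
    have h2 := congrFun h1 (g.1 b).succ
    rw [Pi.single_eq_same, hidx, Pi.single_eq_same] at h2
    revert h2
    rcases hs with rfl | rfl <;> cases g.2 b <;> cases h.2 b <;> simp
  exact Prod.ext (Equiv.ext fun b => (key b).1) (funext fun b => (key b).2)

/-- ★★ **`2^u · u!` DIVIDES `F_{c,n}(u)`**: the number of irreducible bridges of `ℤ^{u+1}` of cost `c` and length `n` using every lateral
axis is divisible by the order of the hyperoctahedral group of the `u` lateral axes, which acts freely on them (Graham's count of classes
`f(a, N, D)`, here for irreducible bridges graded by cost). [cite: Graham2010, Section 4] -/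
theorem two_pow_mul_factorial_dvd_card_allAxesClass (u c n : ℕ) :
    2 ^ u * u.factorial ∣ ((irreducibleBridges (u + 1) n).filter fun (ω : ℕ → Site (u + 1)) => costZd u n ω = c ∧
        ∀ a : Fin (u + 1), a ≠ 0 → ∃ i ≤ n, ω i a ≠ (0 : ℤ)).card := by
  classical
  have hcard : (univ : Finset (Equiv.Perm (Fin u) × (Fin u → Bool))).card = 2 ^ u * u.factorial := by
    rw [card_univ, Fintype.card_prod, Fintype.card_perm, Fintype.card_fun, Fintype.card_bool, Fintype.card_fin, mul_comm]
  rw [← hcard]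
  refine card_dvd_card_of_free_action univ
    (fun (g : Equiv.Perm (Fin u) × (Fin u → Bool)) (ω : ℕ → Site (u + 1)) => fun i => latRelabel u g (ω i))
    univ_nonempty ?_ ?_ _ ?_ ?_
  · intro g _ h _
    exact ⟨(g.1 * h.1, fun j => xor (h.2 j) (g.2 (h.1 j))), mem_univ _,
      fun ω => funext fun i => (latRelabel_latRelabel g h (ω i)).symm⟩
  · intro g _
    exact ⟨(g.1.symm, fun j => g.2 (g.1.symm j)), mem_univ _, fun ω => funext fun i => latRelabel_symm_latRelabel g (ω i)⟩
  · intro g _ ω hω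
    rw [mem_filter] at hω ⊢
    exact ⟨(comp_latRelabel_mem_irreducibleBridges_iff g ω).2 hω.1, by rw [costZd_comp_latRelabel]; exact hω.2.1,
      (forall_exists_latRelabel_iff g ω).2 hω.2.2⟩
  · intro g _ h _ ω hω e
    rw [mem_filter] at hω
    exact latRelabel_free (mem_bridges.1 (mem_irreducibleBridges.1 hω.1).1).1 hω.2.2 e

end Free

/-! ## §3 The census in the hyperoctahedral normal form: `N_{c,n}(ℤ^{d+1}) = Σ_u G_{c,n}(u) · 2d(2d−2)⋯(2d−2u+2)` -/

section Census

/-- `∏_{i<u} (2d − 2i) = 2^u · d(d−1)⋯(d−u+1)` in `ℤ`. [folklore] -/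
private theorem prod_range_two_mul_sub_hyp (d : ℕ) :
    ∀ u : ℕ, ∏ i ∈ Finset.range u, (2 * (d : ℤ) - 2 * (i : ℤ)) = 2 ^ u * (d.descFactorial u : ℤ)
  | 0 => by simp
  | u + 1 => by
    rw [Finset.prod_range_succ, prod_range_two_mul_sub_hyp d u, Nat.descFactorial_succ, pow_succ]
    rcases Nat.lt_or_ge d u with hdu | hdu
    · rw [(Nat.descFactorial_eq_zero_iff_lt).2 hdu]
      push_cast
      ring
    · push_cast [Nat.cast_sub hdu]
      ring

/-- ★★★ **THE CENSUS IN THE HYPEROCTAHEDRAL NORMAL FORM**: for every cost `c`, length `n` and EVERY dimension `d`,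
`N_{c,n}(ℤ^{d+1}) = Σ_{u=0}^{c} G_{c,n}(u) · 2^u · d(d−1)⋯(d−u+1) = Σ_u G_{c,n}(u) · 2d(2d−2)⋯(2d−2u+2)`, where
`G_{c,n}(u) = F_{c,n}(u) / (2^u u!) ∈ ℕ` is the number of classes, under the signed permutations of the lateral axes, of the irreducible bridges
of `ℤ^{u+1}` of cost `c` and length `n` using every lateral axis — so `N_{c,n}` is an INTEGER polynomial in the number `2d` of lateral
directions. [cite: Graham2010, Section 4 (the device, for lace-graph counts)] [cite: MadrasSlade1993, §1.1 eq. (1.1.8) p. 5 (the 1/d expansion)] -/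
theorem costCoeffZd_eq_sum_classes_mul_descFactorial (d c n : ℕ) :
    costCoeffZd d c n = ∑ u ∈ Finset.range (c + 1),
      ((irreducibleBridges (u + 1) n).filter fun (ω : ℕ → Site (u + 1)) => costZd u n ω = c ∧
        ∀ a : Fin (u + 1), a ≠ 0 → ∃ i ≤ n, ω i a ≠ (0 : ℤ)).card / (2 ^ u * u.factorial) * (2 ^ u * d.descFactorial u) := by
  rw [costCoeffZd_eq_sum_choose_mul]
  refine Finset.sum_congr rfl fun u _ => ?_
  obtain ⟨G, hG⟩ := two_pow_mul_factorial_dvd_card_allAxesClass u c n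
  rw [hG, Nat.mul_div_cancel_left _ (by positivity), Nat.descFactorial_eq_factorial_mul_choose]
  ring

/-- ★★ Existential form: `N_{c,n}(ℤ^{d+1}) = Σ_{u ≤ c} G(u) · 2^u · d(d−1)⋯(d−u+1)` with a `d`-independent `G : ℕ → ℕ`, `G(0) = 0` when
`c ≥ 1` (no irreducible bridge of positive cost lives on the force axis alone). [cite: Graham2010, Section 4] -/
theorem exists_costCoeffZd_eq_sum_mul_descFactorial (c n : ℕ) :
    ∃ G : ℕ → ℕ, (1 ≤ c → G 0 = 0) ∧
      ∀ d : ℕ, costCoeffZd d c n = ∑ u ∈ Finset.range (c + 1), G u * (2 ^ u * d.descFactorial u) := by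
  refine ⟨fun u => ((irreducibleBridges (u + 1) n).filter fun (ω : ℕ → Site (u + 1)) => costZd u n ω = c ∧
      ∀ a : Fin (u + 1), a ≠ 0 → ∃ i ≤ n, ω i a ≠ (0 : ℤ)).card / (2 ^ u * u.factorial), fun hc => ?_,
    fun d => costCoeffZd_eq_sum_classes_mul_descFactorial d c n⟩
  -- at `d = 0` only the `u = 0` term survives, and `N_{c,n}(ℤ¹) = 0` for `c ≥ 1`
  have h0 := costCoeffZd_eq_sum_classes_mul_descFactorial 0 c n
  rw [costCoeffZd_zero_dim_eq_zero hc, Finset.sum_range_succ'] at h0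
  simp only [Nat.descFactorial_succ, Nat.zero_sub, zero_mul, mul_zero, Finset.sum_const_zero, zero_add,
    Nat.descFactorial_zero, pow_zero, mul_one, Nat.factorial_zero, Nat.div_one] at h0
  simpa using h0.symm

/-- ★★★ **`N_{c,n}(ℤ^{d+1})` IS AN INTEGER POLYNOMIAL IN `2d`**: there is `P_{c,n} ∈ ℤ[X]` of degree `≤ c`, with ZERO CONSTANT TERM when
`c ≥ 1`, such that `N_{c,n}(ℤ^{d+1}) = P_{c,n}(2d)` for every `d ∈ ℕ` (namely `P_{c,n} = Σ_{u ≤ c} G_{c,n}(u) ∏_{i<u} (X − 2i)`). Compare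
`exists_polynomial_costCoeffZd` (the same over `ℚ`, in the variable `d`). [cite: Graham2010, Section 4 ("a polynomial in powers of
s⁻¹ = 2d" with integer coefficients)] [cite: MadrasSlade1993, §1.1 eq. (1.1.8) p. 5] -/
theorem exists_int_polynomial_costCoeffZd (c n : ℕ) :
    ∃ P : Polynomial ℤ, P.natDegree ≤ c ∧ (1 ≤ c → P.coeff 0 = 0) ∧
      ∀ d : ℕ, (costCoeffZd d c n : ℤ) = P.eval (2 * (d : ℤ)) := by
  obtain ⟨G, hG0, hG⟩ := exists_costCoeffZd_eq_sum_mul_descFactorial c n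
  refine ⟨∑ u ∈ Finset.range (c + 1), Polynomial.C ((G u : ℕ) : ℤ) *
      ∏ i ∈ Finset.range u, (Polynomial.X - Polynomial.C (2 * (i : ℤ))), ?_, ?_, ?_⟩
  · refine Polynomial.natDegree_sum_le_of_forall_le _ _ fun u hu => ?_
    refine (Polynomial.natDegree_C_mul_le _ _).trans ?_
    refine (Polynomial.natDegree_prod_le _ _).trans ?_
    calc ∑ i ∈ Finset.range u, (Polynomial.X - Polynomial.C (2 * (i : ℤ))).natDegree
        ≤ ∑ _i ∈ Finset.range u, 1 :=
          Finset.sum_le_sum (f := fun i : ℕ => (Polynomial.X - Polynomial.C (2 * (i : ℤ))).natDegree) (g := fun _ => 1)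
            fun i _ => Polynomial.natDegree_X_sub_C_le (2 * (i : ℤ))
      _ = u := by simp
      _ ≤ c := by simpa [Finset.mem_range, Nat.lt_succ_iff] using hu
  · intro hc
    rw [Polynomial.finsetSum_coeff]
    refine Finset.sum_eq_zero fun u _ => ?_
    rw [Polynomial.coeff_C_mul, Polynomial.coeff_zero_eq_eval_zero, Polynomial.eval_prod]
    rcases Nat.eq_zero_or_pos u with rfl | hu
    · simp [hG0 hc]
    · rw [Finset.prod_eq_zero (Finset.mem_range.2 hu) (by simp), mul_zero]
  · intro d
    rw [hG d, Polynomial.eval_finsetSum]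
    push_cast
    refine Finset.sum_congr rfl fun u _ => ?_
    rw [Polynomial.eval_mul, Polynomial.eval_C, Polynomial.eval_prod]
    simp only [Polynomial.eval_sub, Polynomial.eval_X, Polynomial.eval_C]
    rw [prod_range_two_mul_sub_hyp d u]

end Census

end Literature.Probability.RandomPlanarGeometry.SAW.Zd

end
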